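import Summits.BirchSwinnertonDyer.Rank1Residual.X9.LeafDischargeKolyvaginCebotarev
import Summits.BirchSwinnertonDyer.BirchSwinnertonDyer.Theorems.ErratumRoadFiveNonSurjCornerImageFull
import Literature.NumberTheory.EllipticCurves.Rank1Residual.X9ImageShape
import Literature.NumberTheory.GaloisRepresentations.ArtinFormalismInductionProofs
import HarnessLib

/-!
# Class X9: the DISCHARGE INTERFACE — at `p ≥ 7` the image is the FULL normaliser of a split
# Cartan subgroup; `−1 ∈ ρ̄_{E,p}(Γ_ℚ)` on ALL of X9, and `−1 ∈ ρ̄_{E,p}(Γ_K)` over quadratic `K`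

Print-tier cell `bsd-print-x9` (D-0131 (2), key `x9`), typer seat ty2, file N of the interface
(`X9/LeafDischarge*.lean`, `X10/LeafDischargeX10b*.lean`). Theorems only: no definition, no named fact
(D-0014 / D-0026); nothing here is a class theorem and nothing is asserted about any curve.

WHY THIS FILE. File F (`X9/LeafDischargeKolyvaginCebotarev`, §5) records `−1 ∈ ρ̄_{E,5}(Γ_ℚ)` on
class X9 at `p = 5` (`ClassX9.exists_smul_eq_neg_of_eq_five`, from the homothety of Serre §2.6) and
remarks that an irreducible non-surjective subgroup of `GL₂(𝔽₇)` need not contain `−1` (Zywina's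
`H_{1,1}`, order `18`). On class X9 that abstract caveat is void: X9 means GOOD ORDINARY reduction at
`p`, so the image contains the inertia half-Cartan `P (1 0; 0 *) P⁻¹` (Serre §1.11), and for `p ≥ 7`
Serre's Prop. 17 + Prop. 14 put the image inside the normaliser `N(C)` of the split Cartan subgroup
`C = P (* 0; 0 *) P⁻¹` of that half-Cartan, not inside `C` (tree THEOREM
`Rank1Residual.exists_splitCartan_normalizer_of_goodOrd`, file `Rank1Residual/X9ImageShape`). One
line of group theory — an element of `G ∖ C` swaps the two half-Cartans, which generate `C`, and
`[N(C) : C] = 2` — pins the image EXACTLY: **`G = N(C)`**, of order `2(p − 1)²` (`72` at `p = 7`: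
Sutherland's `7Ns` is the full normaliser; Zywina 2015 Thm. 1.5 (ℓ = 7), `G₂ = N_s(7)`). That line is
already in the tree for the MULTIPLICATIVE corner of rung K2 (cell `bsd-stepL`, seat corner5-p2:
`CornerShape.eq_normalizer_splitCartan_of_halfSplitCartan_le`, file
`Theorems/ErratumRoadFiveNonSurjCornerImageFull`, whose §2 is the `Mult W p` twin of §1 below); here
it is composed with the GOOD-ORDINARY frame theorem of X9. Consequences, all UNCONDITIONAL:

1. `ClassX9.image_eq_normalizer_splitCartan` (`p ≥ 7`): `Φ(ρ̄_{E,p}(Γ_ℚ)) = N(P (* 0; 0 *) P⁻¹)`;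
   `ClassX9.splitCartan_le_image`: the whole split Cartan subgroup lies in the image.
2. `ClassX9.exists_smul_eq_neg` — **on ALL of class X9 some `γ ∈ Γ_ℚ` acts as `−1` on `E[p]`**
   (`p = 5`: file F; `p ≥ 7`: `−1 ∈ C ≤ G`); `ClassX9.exists_smul_eq_neg_pow`: on `E[p^M]`.
   This is, verbatim, binder (ii) «`p = 7 → ∃ γ, ∀ P : E[p], γ • P = −P`» of the swap-input theorem
   `X11b.Three.Koly.nonSurjCornerKolyJ_max_of_swapInputs_of_perLevel`
   (`Theorems/ErratumRoadFiveNonSurjCornerKolyJSwapInputs`, the McCallum §5 prime-swap kernel of cell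
   `bsd-stepL` corner-p1 — the kernel line named for the `Prop52X9` residue of crux 20392
   `HeegnerDivisibilityX9` of route `PrintX9`), now discharged on every X9 frame: `ClassX9.swapInput_neg`.
3. `ClassX9.exists_sq_smul_eq_neg_of_seven_le` — at `p ≥ 7`, `−1` is a SQUARE in the image
   (`m = P (0 −1; 1 0) P⁻¹ ∈ N(C) = G`, `m² = −1`), hence `ClassX9.exists_smul_eq_neg_baseChange_of_finrank_eq_two`:
   **for EVERY quadratic field `K`, some `z ∈ Γ_K` acts as `−1` on `E(K̄)[p]`** (`γ² ∈ Γ_K` as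
   `[Γ_ℚ : Γ_K] = 2`) and on `E(K̄)[p^M]` — no Heegner hypothesis, no disjointness, no condition on `d_K`
   (the X10b twin at `p = 3` is file I's `ClassX10.exists_smul_eq_neg_baseChange[_pow]`).
4. Heegner frames, `p`-uniform: `ClassX9.exists_smul_eq_neg_baseChange_of_heegner` and
   `…_pow_of_heegner` (file F's `_of_eq_five` versions without the `p = 5` binder) — the `hz`/`hz'`
   inputs («some `z ∈ Γ_K` acts as `−1` on `E[p^M]`») of the tree's Kolyvagin pairing lemmas
   (`KolyvaginPairing.eq_zero_of_h1Eval_eq_zero`, `exists_kolyvaginPrime_gt_pow_of_image`,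
   `McCallum1991_cor_3_2_pow_of_irr_of_neg`) on every X9 Heegner frame with `p` split.
5. (appended §4) `exists_prime_dvd_discr_of_heegner` — on a Heegner frame with `p` split some prime
   `q ∣ d_K` has `q ∤ N_E`, `q ≠ p` (binder (i) of the same swap-input theorem, Gross's disjointness
   prime); `ClassX9.swapInputs_image` = conjuncts (i) ∧ (ii) of `hswapIn` verbatim.

Decl namespace `Literature.NumberTheory.EllipticCurves.Rank1Residual` (dot notation on the census
predicate `Rank1Residual.ClassX9` of `Rank1Residual/Predicates.lean`, as in files A–M).

## References (locators only; the statements used are tree theorems)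

* [Serre1972] J.-P. Serre, Invent. Math. 15 (1972): §1.11 Prop. 11 and Cor. (inertia half-Cartan at a
  good ordinary prime); §2.1 a), §2.2 (`(N : C) = 2`, `N ∖ C` swaps `D₁, D₂`), Prop. 14; §2.7 Prop. 17;
  §4.2 b).
* [Zywina2015] D. Zywina, arXiv:1508.07660, Thm. 1.5 (i)+(iii) (ℓ = 7: the irreducible non-surjective
  images `G₁`, `G₂ = N_s(7)`, `G₆ = N_ns(7)`, `H_{1,1}`; `H_{1,1}` only for curves additive at `7`).
* [McCallumLMS1991] W. McCallum, in LMS LNS 153 (1991), §3 (standing use of `−1` on `E_p`), §5 Prop. 5.2.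
* [GrossLMS1991] B. Gross, in LMS LNS 153 (1991), §9 Prop. 9.1 (the central subgroup `Z ∋ −1`).
-/

set_option autoImplicit false

noncomputable section

open scoped Classical

universe u

open WeierstrassCurve NumberField Field Matrix
  Literature.NumberTheory.GaloisRepresentations Literature.NumberTheory.GaloisRepresentations.Serre1972
  Literature.NumberTheory.EllipticCurves
  Summit.BirchSwinnertonDyer.BirchSwinnertonDyer.Theorems.CornerShape

namespace Literature.NumberTheory.EllipticCurves.Rank1Residual

/-! ### 1. Framed statements: the image at a good ordinary exceptional `p ≥ 7` is `N(C)` -/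

section Frame

variable (W : WeierstrassCurve ℚ) [W.IsElliptic] [W.IsGloballyMinimal] (p : ℕ) [Fact p.Prime]
  (Φ : Multiplicative (AddAut (geomTorsion W p)) ≃* GL (Fin 2) (ZMod p))
  (e : geomTorsion W p ≃+ (Fin 2 → ZMod p))
  (he : ∀ (g : Multiplicative (AddAut (geomTorsion W p))) (x : geomTorsion W p),
    e (Multiplicative.toAdd g x) =
      ((Φ g : GL (Fin 2) (ZMod p)) : Matrix (Fin 2) (Fin 2) (ZMod p)) *ᵥ e x)

include he

/-- **At a prime `p ≥ 7` of good ordinary reduction with `E[p]` irreducible and `ρ̄_{E,p}` not onto,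
the image is EXACTLY the normaliser of a split Cartan subgroup**: `Φ(ρ̄_{E,p}(Γ_ℚ)) = N(P (* 0; 0 *) P⁻¹)`
for the frame `P` of the inertia half-Cartan (`Rank1Residual.exists_splitCartan_normalizer_of_goodOrd`:
`P (1 0; 0 *) P⁻¹ ≤ G ≤ N(C)`, `G ⊄ C`; then `CornerShape.eq_normalizer_splitCartan_of_halfSplitCartan_le`).
The good-ordinary twin of `CornerShape.image_eq_normalizer_splitCartan` (multiplicative reduction).
[cite: Serre1972, §2.2 and §2.7 Prop. 17, §4.2 b)] [cite: Zywina2015, Thm. 1.5 (ℓ = 7: G₂ = N_s(7))] -/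
theorem image_eq_normalizer_splitCartan_of_goodOrd (h7 : 7 ≤ p) (hord : GoodOrd W p)
    (hirr : Irr W p) (hns : ¬ Surj W p) :
    ∃ P : GL (Fin 2) (ZMod p),
      halfSplitCartan P ≤ (galoisRepTorsion W p).range.map Φ.toMonoidHom ∧
      (galoisRepTorsion W p).range.map Φ.toMonoidHom =
        Subgroup.normalizer (splitCartan P : Set (GL (Fin 2) (ZMod p))) := by
  obtain ⟨P, hCG, hGN, hGC⟩ := exists_splitCartan_normalizer_of_goodOrd W p Φ e he h7 hord hirr hns
  exact ⟨P, hCG, eq_normalizer_splitCartan_of_halfSplitCartan_le (exists_units_ne_one (by omega))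
    hCG hGN hGC⟩

/-- **X9 at `p ≥ 7` ⟹ the image is the full normaliser of the split Cartan subgroup of the inertia
half-Cartan** (class form): Sutherland's label `7Ns` on an X9 pair means ALL of `N(C_s)`, order `72`.
[cite: Serre1972, §2.2 and §2.7 Prop. 17] [cite: Zywina2015, Thm. 1.5 (ℓ = 7)] -/
theorem ClassX9.image_eq_normalizer_splitCartan (h : ClassX9 W p) (h7 : 7 ≤ p) :
    ∃ P : GL (Fin 2) (ZMod p),
      halfSplitCartan P ≤ (galoisRepTorsion W p).range.map Φ.toMonoidHom ∧
      (galoisRepTorsion W p).range.map Φ.toMonoidHom =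
        Subgroup.normalizer (splitCartan P : Set (GL (Fin 2) (ZMod p))) :=
  image_eq_normalizer_splitCartan_of_goodOrd W p Φ e he h7 h.goodOrd h.irr h.not_surj

/-- **X9 at `p ≥ 7` ⟹ the whole split Cartan subgroup `P (* 0; 0 *) P⁻¹` lies in the image**
(`C ≤ N(C) = G`): over the quadratic field `M` cut out by `U = ρ̄⁻¹(C)`
(`ClassX9.exists_index_two_subgroup`) the two characters of `E[p]|_{Γ_M}` are jointly onto
`𝔽_pˣ × 𝔽_pˣ`. [cite: Serre1972, §2.1 a), §2.2] -/
theorem ClassX9.splitCartan_le_image (h : ClassX9 W p) (h7 : 7 ≤ p) :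
    ∃ P : GL (Fin 2) (ZMod p),
      splitCartan P ≤ (galoisRepTorsion W p).range.map Φ.toMonoidHom ∧
      (galoisRepTorsion W p).range.map Φ.toMonoidHom =
        Subgroup.normalizer (splitCartan P : Set (GL (Fin 2) (ZMod p))) := by
  obtain ⟨P, -, hG⟩ := h.image_eq_normalizer_splitCartan W p Φ e he h7
  exact ⟨P, hG ▸ Subgroup.le_normalizer, hG⟩

/-- **`−1 ∈ Φ(ρ̄_{E,p}(Γ_ℚ))` at a good ordinary exceptional `p ≥ 7`, framed**: some `γ ∈ Γ_ℚ` has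
`Φ(ρ̄ γ) = −1` (`−1 ∈ C ≤ N(C) = G`). [cite: Serre1972, §2.2] -/
theorem exists_apply_eq_neg_one_of_goodOrd (h7 : 7 ≤ p) (hord : GoodOrd W p) (hirr : Irr W p)
    (hns : ¬ Surj W p) :
    ∃ γ : absoluteGaloisGroup ℚ, Φ (galoisRepTorsion W p γ) = -1 := by
  obtain ⟨P, -, hG⟩ := image_eq_normalizer_splitCartan_of_goodOrd W p Φ e he h7 hord hirr hns
  have hmem : (-1 : GL (Fin 2) (ZMod p)) ∈ (galoisRepTorsion W p).range.map Φ.toMonoidHom := by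
    rw [hG]; exact Subgroup.le_normalizer (neg_one_mem_splitCartan P)
  exact (mem_map_range_galoisRepTorsion_iff W p Φ).mp hmem

omit [W.IsElliptic] [W.IsGloballyMinimal] he in
/-- **The quarter turn of a frame**: `m = P (0 −1; 1 0) P⁻¹` normalises `P (* 0; 0 *) P⁻¹` (it is
antidiagonal in the frame `P`) and `m² = −1`. [cite: Serre1972, §2.2] -/
theorem exists_mem_normalizer_splitCartan_mul_self_eq_neg_one (P : GL (Fin 2) (ZMod p)) :
    ∃ m ∈ Subgroup.normalizer (splitCartan P : Set (GL (Fin 2) (ZMod p))), m * m = -1 := by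
  set w : GL (Fin 2) (ZMod p) :=
    GeneralLinearGroup.mkOfDetNeZero !![(0 : ZMod p), -1; 1, 0] (by simp [Matrix.det_fin_two])
    with hw
  have hwad : GL2.IsAd (w : Matrix (Fin 2) (Fin 2) (ZMod p)) := ⟨rfl, rfl⟩
  have hww : w * w = -1 := by
    refine Units.ext ?_
    rw [Units.val_mul, Units.val_neg, Units.val_one]
    ext i j
    fin_cases i <;> fin_cases j <;> simp [hw, Matrix.one_fin_two]
  refine ⟨P * w * P⁻¹, mem_normalizer_splitCartan_of_isAd (by
    have : (P⁻¹ * (P * w * P⁻¹) * P : GL (Fin 2) (ZMod p)) = w := by group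
    rw [this]; exact hwad), ?_⟩
  calc P * w * P⁻¹ * (P * w * P⁻¹) = P * (w * w) * P⁻¹ := by group
    _ = -1 := by rw [hww, mul_neg, mul_one, neg_mul, mul_inv_cancel]

/-- **`−1` is a SQUARE in `Φ(ρ̄_{E,p}(Γ_ℚ))` at a good ordinary exceptional `p ≥ 7`, framed**: some
`γ ∈ Γ_ℚ` has `Φ(ρ̄ (γ·γ)) = −1` (`ρ̄ γ ↦ P (0 −1; 1 0) P⁻¹ ∈ N(C) = G`). [cite: Serre1972, §2.2] -/
theorem exists_apply_mul_self_eq_neg_one_of_goodOrd (h7 : 7 ≤ p) (hord : GoodOrd W p)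
    (hirr : Irr W p) (hns : ¬ Surj W p) :
    ∃ γ : absoluteGaloisGroup ℚ, Φ (galoisRepTorsion W p (γ * γ)) = -1 := by
  obtain ⟨P, -, hG⟩ := image_eq_normalizer_splitCartan_of_goodOrd W p Φ e he h7 hord hirr hns
  obtain ⟨m, hmN, hmm⟩ := exists_mem_normalizer_splitCartan_mul_self_eq_neg_one p P
  have hmem : m ∈ (galoisRepTorsion W p).range.map Φ.toMonoidHom := by rw [hG]; exact hmN
  obtain ⟨γ, hγ⟩ := (mem_map_range_galoisRepTorsion_iff W p Φ).mp hmem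
  exact ⟨γ, by rw [map_mul, map_mul, hγ, hmm]⟩

end Frame

/-! ### 2. Frame-free, over `ℚ`: `−1 ∈ ρ̄_{E,p}(Γ_ℚ)` on all of X9 -/

section X9

variable {W : WeierstrassCurve ℚ} [W.IsElliptic] [W.IsGloballyMinimal] {p : ℕ} [Fact p.Prime]

/-- A prime `p ≥ 5` other than `5` is at least `7`. [folklore] -/
theorem seven_le_of_five_le_of_ne_five (h5 : 5 ≤ p) (hne : p ≠ 5) : 7 ≤ p := by
  have hp : p.Prime := Fact.out
  by_contra hlt
  have h6 : p = 6 := by omega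
  exact absurd (h6 ▸ hp) (by decide)

omit [W.IsElliptic] in
/-- X9 ⟹ `p = 5 ∨ 7 ≤ p` (the prime `p ≥ 5` of the class). [folklore] -/
theorem ClassX9.eq_five_or_seven_le (h : ClassX9 W p) : p = 5 ∨ 7 ≤ p := by
  by_cases h5 : p = 5
  · exact Or.inl h5
  · exact Or.inr (seven_le_of_five_le_of_ne_five h.five_le h5)

variable (W p) in
/-- **`−1 ∈ ρ̄_{E,p}(Γ_ℚ)` at every good ordinary exceptional prime `p ≥ 7`**, frame-free: for `W/ℚ`
elliptic with good ordinary reduction at `p ≥ 7`, `E[p]` irreducible and `ρ̄_{E,p}` not onto, some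
`γ ∈ Γ_ℚ` acts as `−1` on `E[p]`. The good-ordinary twin of
`CornerShape.exists_smul_eq_neg_of_mult_of_irr_of_not_surj`. [cite: Serre1972, §2.2 and §2.7 Prop. 17] -/
theorem exists_smul_eq_neg_of_goodOrd_of_irr_of_not_surj (h7 : 7 ≤ p) (hord : GoodOrd W p)
    (hirr : Irr W p) (hns : ¬ Surj W p) :
    ∃ γ : absoluteGaloisGroup ℚ, ∀ P : geomTorsion W p, γ • P = -P := by
  obtain ⟨e, Φ, he, -⟩ := exists_frame_galoisRepTorsion_rat W p
  obtain ⟨γ, hγ⟩ := exists_apply_eq_neg_one_of_goodOrd W p Φ e he h7 hord hirr hns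
  exact ⟨γ, smul_eq_neg_of_apply_eq_neg_one W p Φ e he hγ⟩

variable (W p) in
/-- **`−1` is a square in `ρ̄_{E,p}(Γ_ℚ)` at every good ordinary exceptional prime `p ≥ 7`**, frame-free:
some `γ ∈ Γ_ℚ` has `γ • γ • P = −P` on `E[p]`. [cite: Serre1972, §2.2] -/
theorem exists_sq_smul_eq_neg_of_goodOrd_of_irr_of_not_surj (h7 : 7 ≤ p) (hord : GoodOrd W p)
    (hirr : Irr W p) (hns : ¬ Surj W p) :
    ∃ γ : absoluteGaloisGroup ℚ, ∀ P : geomTorsion W p, γ • γ • P = -P := by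
  obtain ⟨e, Φ, he, -⟩ := exists_frame_galoisRepTorsion_rat W p
  obtain ⟨γ, hγ⟩ := exists_apply_mul_self_eq_neg_one_of_goodOrd W p Φ e he h7 hord hirr hns
  exact ⟨γ, fun P ↦ by rw [← mul_smul]; exact smul_eq_neg_of_apply_eq_neg_one W p Φ e he hγ P⟩

/-- **X9 at `p ≥ 7` ⟹ some `γ ∈ Γ_ℚ` acts as `−1` on `E[p]`.** [cite: Serre1972, §2.2 and §2.7 Prop. 17] -/
theorem ClassX9.exists_smul_eq_neg_of_seven_le (h : ClassX9 W p) (h7 : 7 ≤ p) :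
    ∃ γ : absoluteGaloisGroup ℚ, ∀ P : geomTorsion W p, γ • P = -P :=
  exists_smul_eq_neg_of_goodOrd_of_irr_of_not_surj W p h7 h.goodOrd h.irr h.not_surj

/-- **X9 at `p ≥ 7` ⟹ `−1` is a square in the image**: some `γ ∈ Γ_ℚ` has `γ • γ • P = −P` on
`E[p]` — what the passage to a quadratic field needs (§3). [cite: Serre1972, §2.2] -/
theorem ClassX9.exists_sq_smul_eq_neg_of_seven_le (h : ClassX9 W p) (h7 : 7 ≤ p) :
    ∃ γ : absoluteGaloisGroup ℚ, ∀ P : geomTorsion W p, γ • γ • P = -P :=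
  exists_sq_smul_eq_neg_of_goodOrd_of_irr_of_not_surj W p h7 h.goodOrd h.irr h.not_surj

/-- **`−1 ∈ ρ̄_{E,p}(Γ_ℚ)` on ALL of class X9**: some `γ ∈ Γ_ℚ` acts as `−1` on `E[p]` — at `p = 5`
by the homothety of Serre §2.6 (file F, `ClassX9.exists_smul_eq_neg_of_eq_five`), at `p ≥ 7` because
the image is the full normaliser of a split Cartan subgroup (§1). UNCONDITIONAL; no per-pair
certificate. [cite: Serre1972, §2.2, §2.6, §2.7 Prop. 17] [cite: MatarNekovar2019, Prop. 5.15 (3) (p. 488)] -/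
theorem ClassX9.exists_smul_eq_neg (h : ClassX9 W p) :
    ∃ γ : absoluteGaloisGroup ℚ, ∀ P : geomTorsion W p, γ • P = -P := by
  rcases h.eq_five_or_seven_le with h5 | h7
  · exact h.exists_smul_eq_neg_of_eq_five h5
  · exact h.exists_smul_eq_neg_of_seven_le h7

/-- **`−1 ∈ ρ_{E,p^M}(Γ_ℚ)` on all of class X9**, every level `M ≥ 1` (the level-`p` element raised
to the power `p^{M−1}`, tree `smul_eq_neg_geomTorsion_pow`). [cite: McCallumLMS1991, §3] -/
theorem ClassX9.exists_smul_eq_neg_pow (h : ClassX9 W p) {M : ℕ} (hM : 1 ≤ M) :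
    ∃ γ : absoluteGaloisGroup ℚ, ∀ P : geomTorsion W ((p ^ M : ℕ) : ℤ), γ • P = -P := by
  obtain ⟨γ, hγ⟩ := h.exists_smul_eq_neg
  have hodd : Odd p := (Fact.out : p.Prime).odd_of_ne_two h.ne_two
  exact ⟨γ ^ p ^ (M - 1), fun P ↦ smul_eq_neg_geomTorsion_pow W hodd hM hγ P⟩

/-- **Binder (ii) of the swap-input theorem, DISCHARGED on every X9 frame** — verbatim the conjunct
«`p = 7 → ∃ γ : Γ_ℚ, ∀ P : E[p], γ • P = −P`» of
`X11b.Three.Koly.nonSurjCornerKolyJ_max_of_swapInputs_of_perLevel` (McCallum §5 Prop. 5.2 prime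
swap, cell `bsd-stepL` corner-p1), there «a genuine restriction at `p = 7`» for the multiplicative
corner until corner5-p2's `NonSurjCorner.exists_smul_eq_neg_seven`; on X9 it is free at every `p`.
[cite: McCallumLMS1991, §5 Prop. 5.2 (p. 304)] [cite: Serre1972, §2.2] -/
theorem ClassX9.swapInput_neg (h : ClassX9 W p) :
    p = 7 → ∃ γ : absoluteGaloisGroup ℚ, ∀ P : geomTorsion W p, γ • P = -P :=
  fun _ ↦ h.exists_smul_eq_neg

/-! ### 3. Over a quadratic field `K`: `−1 ∈ ρ̄_{E,p}(Γ_K)` -/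

/-- **X9 at `p ≥ 7` ⟹ for EVERY quadratic field `K` some `z ∈ Γ_K` acts as `−1` on `E(K̄)[p]`**:
`−1 = ρ̄(γ²)` (§2) and `γ² ∈ Γ_K` since `[Γ_ℚ : Γ_K] = 2` (`index_range_absGaloisRestrict_eq_finrank`);
transport along `RatClosure.torsionEquiv`. No Heegner hypothesis, no disjointness `K ∩ ℚ(E[p]) = ℚ`,
no condition on `d_K`. The input `hz` of the tree's Kolyvagin pairing machine
(`KolyvaginPairing.eq_zero_of_h1Eval_eq_zero`) and of `McCallum1991_cor_3_2_pow_of_irr_of_neg`.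
(X10b twin at `p = 3`: `ClassX10.exists_smul_eq_neg_baseChange`, file I.)
[cite: GrossLMS1991, §9 Prop. 9.1] [cite: Serre1972, §2.2] -/
theorem ClassX9.exists_smul_eq_neg_baseChange_of_finrank_eq_two (h : ClassX9 W p) (h7 : 7 ≤ p)
    (K : Type u) [Field K] [NumberField K] (hK : Module.finrank ℚ K = 2) :
    ∃ z : absoluteGaloisGroup K, ∀ Q : geomTorsion (W.baseChange K) p, z • Q = -Q := by
  obtain ⟨γ, hγ⟩ := h.exists_sq_smul_eq_neg_of_seven_le h7
  set H := (absGaloisRestrict ℚ K).range with hH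
  have hHi : H.index = 2 := (index_range_absGaloisRestrict_eq_finrank ℚ K).trans hK
  haveI : H.Normal := Subgroup.normal_of_index_eq_two hHi
  haveI : H.FiniteIndex := ⟨by rw [hHi]; decide⟩
  obtain ⟨g, hg⟩ : γ ^ 2 ∈ H := by
    have := Subgroup.pow_index_mem H γ
    rwa [hHi] at this
  refine ⟨g, fun Q ↦ ?_⟩
  set θ := RatClosure.torsionEquiv (K := K) W (p : ℤ) with hθ
  obtain ⟨P, rfl⟩ := θ.surjective Q
  change (absGaloisRestrict ℚ K) g = γ ^ 2 at hg
  rw [← RatClosure.torsionEquiv_smul, hg, pow_two, mul_smul, hγ, map_neg]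

/-- **X9 at `p ≥ 7` ⟹ for every quadratic `K` and every `M ≥ 1` some `z ∈ Γ_K` acts as `−1` on
`E(K̄)[p^M]`** (the input `hz'` of McCallum's level-`p^M` pairing lemmas,
`HeegnerPointsKolyvaginPrimaryPairingProofs`). [cite: McCallumLMS1991, §3] -/
theorem ClassX9.exists_smul_eq_neg_baseChange_pow_of_finrank_eq_two (h : ClassX9 W p) (h7 : 7 ≤ p)
    (K : Type u) [Field K] [NumberField K] (hK : Module.finrank ℚ K = 2) {M : ℕ} (hM : 1 ≤ M) :
    ∃ z : absoluteGaloisGroup K,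
      ∀ Q : geomTorsion (W.baseChange K) ((p ^ M : ℕ) : ℤ), z • Q = -Q := by
  obtain ⟨z, hz⟩ := h.exists_smul_eq_neg_baseChange_of_finrank_eq_two h7 K hK
  have hodd : Odd p := (Fact.out : p.Prime).odd_of_ne_two h.ne_two
  exact ⟨z ^ p ^ (M - 1), fun Q ↦ smul_eq_neg_geomTorsion_pow (W.baseChange K) hodd hM hz Q⟩

/-- **`−1 ∈ ρ̄_{E,p}(Γ_K)` on EVERY X9 Heegner frame with `p` split** (`p = 5` and `p ≥ 7` alike):
the element of `ClassX9.exists_smul_eq_neg` acts through some `z ∈ Γ_K` (full image over `K`, file F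
§1 `ClassX9.kolyvaginImage_full_of_heegner`). Supersedes file F's `…_of_heegner_of_eq_five`.
[cite: GrossLMS1991, §9 Prop. 9.1 (the central subgroup Z ∋ −1)] [cite: MatarNekovar2019, Prop. 5.26 (1)] -/
theorem ClassX9.exists_smul_eq_neg_baseChange_of_heegner (h : ClassX9 W p) {K : Type u} [Field K]
    [NumberField K] (hK : IsImaginaryQuadratic K)
    (hHN : SatisfiesHeegnerHypothesis (W.conductorNorm ℤ) K) (hHp : SatisfiesHeegnerHypothesis p K) :
    ∃ z : absoluteGaloisGroup K, ∀ Q : geomTorsion (W.baseChange K) p, z • Q = -Q := by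
  obtain ⟨γ, hγ⟩ := h.exists_smul_eq_neg
  obtain ⟨g, hg⟩ := h.kolyvaginImage_full_of_heegner hK hHN hHp γ
  refine ⟨g, fun Q ↦ ?_⟩
  set θ := RatClosure.torsionEquiv (K := K) W (p : ℤ) with hθ
  obtain ⟨P, rfl⟩ := θ.surjective Q
  rw [← RatClosure.torsionEquiv_smul, hg, hγ, map_neg]

/-- **`−1 ∈ ρ_{E,p^M}(Γ_K)` on every X9 Heegner frame with `p` split**, every level `M ≥ 1`
(supersedes file F's `…_pow_of_heegner_of_eq_five`). [cite: McCallumLMS1991, §3] -/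
theorem ClassX9.exists_smul_eq_neg_baseChange_pow_of_heegner (h : ClassX9 W p) {K : Type u}
    [Field K] [NumberField K] (hK : IsImaginaryQuadratic K)
    (hHN : SatisfiesHeegnerHypothesis (W.conductorNorm ℤ) K) (hHp : SatisfiesHeegnerHypothesis p K)
    {M : ℕ} (hM : 1 ≤ M) :
    ∃ z : absoluteGaloisGroup K,
      ∀ Q : geomTorsion (W.baseChange K) ((p ^ M : ℕ) : ℤ), z • Q = -Q := by
  obtain ⟨z, hz⟩ := h.exists_smul_eq_neg_baseChange_of_heegner hK hHN hHp
  have hodd : Odd p := (Fact.out : p.Prime).odd_of_ne_two h.ne_two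
  exact ⟨z ^ p ^ (M - 1), fun Q ↦ smul_eq_neg_geomTorsion_pow (W.baseChange K) hodd hM hz Q⟩

end X9

/-! ### 4. Binder (i) of the swap inputs: a prime of `d_K` away from `p N_E` (appended) -/

section DisjointPrime

/-- **On a Heegner frame with `p` split, `d_K` has a prime factor `q` with `q ∤ N` and `q ≠ p`** —
ANY prime factor of `d_K` will do (`|d_K| > 1` for a quadratic field: `d_K` is a fundamental
discriminant, `Quadratic.isFundamentalDiscriminant_discr`): the primes dividing `N`, and `p`, split in
`K`, hence do not divide `d_K` (`SatisfiesHeegnerHypothesis.not_dvd_discr`). Gross's disjointness prime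
(`q` ramified in `K`, unramified in `ℚ(E[p^∞])`), verbatim binder (i)
«`∃ q, q.Prime ∧ (q : ℤ) ∣ d_K ∧ ¬ q ∣ N_E ∧ q ≠ p`» of
`X11b.Three.Koly.nonSurjCornerKolyJ_max_of_swapInputs_of_perLevel`, free on every Heegner frame.
[cite: GrossLMS1991, §1 (p. 235) and §9 (before Prop. 9.1)] -/
theorem exists_prime_dvd_discr_of_heegner {K : Type u} [Field K] [NumberField K]
    (hK : IsImaginaryQuadratic K) {N : ℕ} (hHN : SatisfiesHeegnerHypothesis N K) {p : ℕ}
    (hp : p.Prime) (hHp : SatisfiesHeegnerHypothesis p K) :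
    ∃ q : ℕ, q.Prime ∧ (q : ℤ) ∣ NumberField.discr K ∧ ¬ q ∣ N ∧ q ≠ p := by
  have hneg : NumberField.discr K < 0 := hK.discr_neg
  have hne : (NumberField.discr K).natAbs ≠ 1 := by
    rcases Literature.NumberTheory.QuadraticFields.Quadratic.isFundamentalDiscriminant_discr hK.1 with
      ⟨h1, -, -⟩ | ⟨hd4, -, -⟩ <;> omega
  obtain ⟨q, hq, hqd⟩ := Nat.exists_prime_and_dvd hne
  have hqd' : (q : ℤ) ∣ NumberField.discr K := Int.natCast_dvd.mpr hqd
  refine ⟨q, hq, hqd',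
    fun hqN ↦ Literature.SatisfiesHeegnerHypothesis.not_dvd_discr hK.1 hHN hq hqN hqd', ?_⟩
  rintro rfl
  exact Literature.SatisfiesHeegnerHypothesis.not_dvd_discr hK.1 hHp hq dvd_rfl hqd'

variable {W : WeierstrassCurve ℚ} [W.IsElliptic] [W.IsGloballyMinimal] {p : ℕ} [Fact p.Prime]

/-- **The two IMAGE conjuncts (i) ∧ (ii) of the swap-input theorem on an X9 Heegner frame with `p`
split**, verbatim the first two conjuncts of the conclusion of `hswapIn` in
`X11b.Three.Koly.nonSurjCornerKolyJ_max_of_swapInputs_of_perLevel` (McCallum §5 Prop. 5.2 prime swap):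
(i) a prime `q ∣ d_K` with `q ∤ N_E`, `q ≠ p`; (ii) `p = 7 → −1 ∈ ρ̄_{E,p}(Γ_ℚ)` (here at every `p`).
What remains of `hswapIn` per frame is (iii) Kolyvagin–Heegner data at admissible conductors and
(iv) the level-`p` swap package — Euler-system content, not image hypotheses.
[cite: McCallumLMS1991, §5 Prop. 5.2 (p. 304)] [cite: GrossLMS1991, §9 Prop. 9.1] -/
theorem ClassX9.swapInputs_image (h : ClassX9 W p) {K : Type u} [Field K] [NumberField K]
    (hK : IsImaginaryQuadratic K) (hHN : SatisfiesHeegnerHypothesis (W.conductorNorm ℤ) K)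
    (hHp : SatisfiesHeegnerHypothesis p K) :
    (∃ q : ℕ, q.Prime ∧ (q : ℤ) ∣ NumberField.discr K ∧ ¬ q ∣ W.conductorNorm ℤ ∧ q ≠ p) ∧
      (p = 7 → ∃ γ : absoluteGaloisGroup ℚ, ∀ P : geomTorsion W p, γ • P = -P) :=
  ⟨exists_prime_dvd_discr_of_heegner hK hHN (Fact.out : p.Prime) hHp, h.swapInput_neg⟩

end DisjointPrime

end Literature.NumberTheory.EllipticCurves.Rank1Residual

end
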